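import Summits.ABC.IUTFork.Conditional.WRowLicenceSocketMOfK
import Summits.ABC.IUTFork.Cor312LicenceWildInhabitedMixed
import Summits.ABC.IUTFork.Cor312LicenceExactContentMGenuine
import Summits.ABC.IUTFork.Cor312HullLicenceLabelZeroM
import Summits.ABC.IUTFork.Cor312ThetaSideSlotTransportK
import HarnessLib

/-!
# Branch C / R-W, reading (U), M line: the M-LEVEL LICENCE AT FIBRES OF SEVERAL LOCAL TYPES FROM THE K-SIDE PACKAGES — a K→M TRANSFER
# MIXED socket whose hypotheses are VERBATIM those of abc-iut-w5-d180's K mixed-fibre socket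
# `Thm311.Real.licence_settingPrVolSharp_of_mixedOrders_of_realises` (`Cor312LicenceWildInhabitedMixed` §2)
# (abc-iut cell, branch C, row «C:BROBERG-M-TWIN»; seat abc-iut-C-cert-2 gen 8; C LEAD KEY `KEY-abc-iut-C-cert-2-BROBERGMTWIN.md` 2026-08-27T15:16Z)

Record-only PROOF file (D-0012; 0 definitions, 0 `Prop` facts, nothing re-typed) of the abc-iut cell. TAKES NO SIDE on [IUTchIII] Cor. 3.12
(S. Mochizuki, *Inter-universal Teichmüller theory III*, Cor. 3.12 p. 173–174; Step (xi-f) p. 184; Thm. 3.11 (i) (Ind1)(Ind2) p. 154) or on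
any author; «inhabited as typed» ≠ «asserted in print».

WHY. Every earlier M socket of this seat carries `hj : E.j ∈ range (algebraMap ℚ F)` (abc-iut-w5-d166's SINGLETON decider
`licence_settingPrVolSharpM_tOfIdeleData_iff_orders_of_j_mem_range`, `fibre_eq_of_j_mem_range`, `norm_tqM_eq_rpow_ord_rat`), so the one K INH
row at a NUMBER-FIELD point — Broberg's `(ℚ(√7), λ)`, `F_mod = ℚ(√7)`, two places of different type over `3` — was out of reach. None of that is
needed: abc-iut-w5-d166's GENERAL decider `licence_settingPrVolSharpM_tOfIdeleData_iff_radii` (`Cor312LicenceExactContentMGenuine`; caps tuples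
`v⃗ : S^±_{i+2} → V̲_u`, tensor-packet differents over `(presAtM D hlog u).kk v⃗`; «all strata, MIXED summands included») is the M twin of the K
radii cell under abc-iut-w5-d180's K MIXED-fibre socket. THIS FILE ports that socket's §2 to the M objects and feeds it from the K side: a member
`x ∈ V̲_u` sits on the place `placeOfM x = placeOf x′` of the K-fibre point `x′ := (fibreEquivPlacesOver X p)⁻¹ ⟨placeOfM x, _⟩` (a FUNCTION of
`x`), its TYPE is `c p x′`, `kOfM … x` and `kOf … x′` are the SAME rescaled completion (index, different, shell witnesses and the in-type
`ℚ_p`-isomorphisms move by substitution), and the q-norm reads the K q-pilot degree: `‖t_{q,x}‖ = p^{−P_q(placeOfM x)/e(placeOfM x)}` (§1, from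
abc-iut-w5-d166's `log_norm_tqM` and the field-independence of the normalised q-height — the q-analogue of this seat's gen-4
`thetaPilot_pilotDataOfK_mul_logNorm_div_localDegree`). The M decider has NO slot permutation (its Θ-side premiss is over EVERY slot), so the
composer's slot `s` of the K cell is simply the slot read; good slots as in abc-iut-W-row-1 (`norm_tqM_eq_one_of_not_mem`, `norm_tqM_le_one`);
the different gain by abc-iut-w5-d180's Literature lemma `sub_le_dSum_sub_inf_differentOrd_dFac_of_types` BY NAME.

* `WRowM.qPilot_pilotDataOfK_mul_logNorm_div_localDegree` — `P_{q,K}(w)·log N(w)/n_w = P_{q,mod}(v)·log N(v)/n_v` for `w ∣ v`;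
* `WRowM.norm_tqM_eq_rpow_qPilot_placeOfM` — `‖t_{q,x}‖ = p^{−P_{q,K}(placeOfM x)/e_{placeOfM x}}` for EVERY member `x` (any `F_mod`);
* **`WRowM.licence_tOfIdeleData_of_mixedOrdersK`** — hypotheses `(ty, c, e, D, P, ρin, ρout, hloc, hiso, hcell)` LETTER FOR LETTER the K
  mixed socket's (at `X := pilotDataOfK D K`) ⟹ `Thm311ToCor312.Licence (settingPrVolSharpM D hlog (tOfIdeleData D r) (tqM … r …) …)` for the
  idele datum `r`, the analytic `logvK`, the context data and `htq0/Sq/htq1` of the ambient section, all arbitrary — NO `hj`, ANY `F_mod`.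

CONSEQUENCE: abc-iut-C-cert-2 gen 3's X-generic `WRow.licence_of_brobergTypes_all` (`WRowBrobergUniform`) twins by SURGERY at
`X := pilotDataOfK D K`, and `WRow.licence_broberg_all` with it (files `WRowBrobergUniformM`, `WRowBrobergUniformDatumM`).

HONEST SCOPE: OUR sharp containers and Dupuy–Hilado's typed (Ind1)/(Ind2); STRONGER-THAN-PRINT hull reading; a socket discharges nothing;
non-emptiness of the datum type, admissibility and Szpiro-badness NOT claimed; existence of initial Θ-data at any given curve NOT claimed;
nothing about the printed GLOBAL inequality or the number-level corollary; typed ≠ proved; instantiated ≠ endorsed; no abc claim.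
[cite: Mochizuki2012, IUTchI Def. 3.1 (b),(c),(e) pp. 61–62, Rmk. 3.1.5 p. 65; IUTchIII Cor. 3.12 p. 173–175, Step (xi) (xi-d)(xi-f)
p. 183–184, Thm. 3.11 (i) p. 154; IUTchIV Prop. 1.1 p. 9, Prop. 1.2 (i)(ii) p. 10, Prop. 1.4 (i) p. 13] [cite: DupuyHilado2025, §3.3, §3.4,
§3.6, §3.9, §4.9, §4.12] [cite: NeukirchANT1999, Ch. I §8 (8.2), Ch. II (4.8), (5.5)] [claim: Mochizuki2012, status: disputed] for every IUT
sentence. PROOF-ONLY: no definitions.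
-/

noncomputable section

open Set Function NumberField IsDedekindDomain
open scoped Pointwise

namespace Summit.ABC.IUTFork.Conditional

open Thm311 Thm311.Real Cor312 Cor312.Setting Cor312Vol Cor312Vol.ExplicitDepth Cor312Prov Literature.IUT.LogThetaLattice
  Literature.IUT.LogVolume Literature.IUT.HodgeTheaters Literature.IUT.LogVolume.Cor22
open Literature.NumberTheory.NumberFields Literature.NumberTheory.GaloisRepresentations.Ultrametric
open Literature.NumberTheory.DiophantineGeometry Literature.NumberTheory.DiophantineGeometry.GenEll

section Own

variable {F K Fbar : Type} [Field F] [NumberField F] [Field K] [NumberField K] [Algebra F K]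
  [Field Fbar] [Algebra F Fbar] [Algebra K Fbar] {E : WeierstrassCurve F} [E.IsElliptic] {l : ℕ}
  {Pb : BadPlacePredicates K} (D : InitialThetaData F K Fbar E l Pb) {logvK : PadicLogsVal K}
  (hlog : LogvAnalyticVal logvK) (r : ThetaData.IdeleData D)
  (M : Type) [Field M] [NumberField M]
  (archPk : ∀ (j : (thetaIndexOfInitial D).Label) (vQ : (thetaIndexOfInitial D).VQ),
    Set ((logShellsOfInitialDH D logvK).Packet j vQ))
  (archSub : ∀ (j : (thetaIndexOfInitial D).Label) (v : (thetaIndexOfInitial D).V),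
    Set ((logShellsOfInitialDH D logvK).Packet j ((thetaIndexOfInitial D).over v)))
  (Ψ : ℤ → ∀ v : (thetaIndexOfInitial D).V, v ∈ (thetaIndexOfInitial D).Vbad →
    Set ((logShellsOfInitialDH D logvK).StarPacket v))
  (act : ℤ → ∀ v : (thetaIndexOfInitial D).V, v ∈ (thetaIndexOfInitial D).Vbad →
    (logShellsOfInitialDH D logvK).StarPacket v → Module.End ℚ ((logShellsOfInitialDH D logvK).StarPacket v))
  (Mmod : ℤ → ∀ j : (thetaIndexOfInitial D).LabelStar, Set ((logShellsOfInitialDH D logvK).GlobalPacket j.1))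
  (region : ℤ → ∀ j : (thetaIndexOfInitial D).LabelStar, FinDivisor M → ∀ vQ : (thetaIndexOfInitial D).VQ,
    Set ((logShellsOfInitialDH D logvK).Packet j.1 vQ))
  (n : ℤ) {HT : Type} {LogLink : HT → HT → Type} {IsFull : ∀ {s t : HT}, LogLink s t → Prop}
  (lat : LGPGaussianLogThetaLattice LogLink IsFull)
  {Frd : Type} {IsoF : Frd → Frd → Type} {Ob : Frd → Type} {realify : Frd → Frd} {Strip : Type}
  {IsoS : Strip → Strip → Type}
  {Mv : ∀ v : (thetaIndexOfInitial D).V, v ∈ (thetaIndexOfInitial D).Vbad → Type} [∀ v h, Monoid (Mv v h)]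
  (sig : GlobalLGPFrobenioidSignature (thetaIndexOfInitial D).lstar (thetaIndexOfInitial D).V
    (· ∈ (thetaIndexOfInitial D).Vbad) Frd IsoF Ob realify Strip IsoS Mv)
  (split : SplittingMonoids Mv) {ObΔ : Type}
  {N : ∀ v : (thetaIndexOfInitial D).V, v ∈ (thetaIndexOfInitial D).Vbad → Type} [∀ v h, Monoid (N v h)]
  (qData : QPilotData ObΔ N)
  (htq0 : ∀ (u : FinitePlace ℚ) (x : (thetaIndexOfInitial D).Fibre (Val.non u)),
    tqM D (ratChar u) u (natCast_ratChar_mem u) r x ≠ 0)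
  (Sq : Finset (FinitePlace ℚ))
  (htq1 : ∀ (u : FinitePlace ℚ) (x : (thetaIndexOfInitial D).Fibre (Val.non u)), u ∉ Sq →
    ‖tqM D (ratChar u) u (natCast_ratChar_mem u) r x‖ = 1)

/-! ## §1. The normalised q-height does not see the field; the M q-idele norm reads the K q-pilot degree -/

omit hlog in
/-- **`P_{q,K}(w)·log N(w)/n_w = P_{q,mod}(v)·log N(v)/n_v` for a place `w` of `K` over the place `v` of `F_mod`** — the q-pilot of the
`K`-level datum `pilotDataOfK D K` (coefficient `ord_w(q)/(2l)`, `ord_w(q) = −ord_w(j_E)`) against that of abc-iut-S2's `pilotData D` over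
`F_mod`; the q-analogue (factor `(i+1)²` dropped, same three lines) of this seat's gen-4 `thetaPilot_pilotDataOfK_mul_logNorm_div_localDegree`
(`ord_mul_logNorm_div_localDegree_algebraMap`: `ord_w = e(w|v)·ord_v`, `log N(w)/n_w = log p/e_w`, `e_w = e(w|v)·e_v`). Off the bad sets both
sides vanish. [cite: DupuyHilado2025, §3.3, §3.4] [cite: NeukirchANT1999, Ch. I §8 Prop. (8.2)] -/
theorem WRowM.qPilot_pilotDataOfK_mul_logNorm_div_localDegree (w : HeightOneSpectrum (𝓞 K)) :
    (pilotDataOfK D K).qPilot w * logNorm K w / (localDegree K w : ℝ) =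
      (ThetaData.pilotData D).qPilot (Literature.IUT.LogVolume.finBelow (fieldOfModuli E) K w) *
          logNorm (fieldOfModuli E) (Literature.IUT.LogVolume.finBelow (fieldOfModuli E) K w) /
        (localDegree (fieldOfModuli E) (Literature.IUT.LogVolume.finBelow (fieldOfModuli E) K w) : ℝ) := by
  by_cases hw : w ∈ (pilotDataOfK D K).S
  · have hv : Literature.IUT.LogVolume.finBelow (fieldOfModuli E) K w ∈ (ThetaData.pilotData D).S :=
      (mem_S_pilotDataOfK_iff_finBelow_mem D w).mp hw
    have hK : ((pilotDataOfK D K).ordq w : ℝ) = -(ord K w (algebraMap (fieldOfModuli E) K (ThetaData.jMod E)) : ℝ) := by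
      rw [PilotData.ordq, pilotDataOfK_jE_eq_algebraMap_jMod]; push_cast; ring
    have hM : ((ThetaData.pilotData D).ordq (Literature.IUT.LogVolume.finBelow (fieldOfModuli E) K w) : ℝ) =
        -(ord (fieldOfModuli E) (Literature.IUT.LogVolume.finBelow (fieldOfModuli E) K w) (ThetaData.jMod E) : ℝ) := by
      rw [PilotData.ordq, ThetaData.pilotData_jE]; push_cast; ring
    have key := ord_mul_logNorm_div_localDegree_algebraMap (F₀ := fieldOfModuli E) w (ThetaData.jMod E)
    rw [(pilotDataOfK D K).qPilot_apply_of_mem hw, (ThetaData.pilotData D).qPilot_apply_of_mem hv, hK, hM,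
      pilotDataOfK_l, ThetaData.pilotData_l]
    calc -(ord K w (algebraMap (fieldOfModuli E) K (ThetaData.jMod E)) : ℝ) / (2 * (l : ℝ)) * logNorm K w / (localDegree K w : ℝ)
        = -(1 / (2 * (l : ℝ))) *
            ((ord K w (algebraMap (fieldOfModuli E) K (ThetaData.jMod E)) : ℝ) * logNorm K w / (localDegree K w : ℝ)) := by ring
      _ = -(1 / (2 * (l : ℝ))) *
            ((ord (fieldOfModuli E) (Literature.IUT.LogVolume.finBelow (fieldOfModuli E) K w) (ThetaData.jMod E) : ℝ) *
              logNorm (fieldOfModuli E) (Literature.IUT.LogVolume.finBelow (fieldOfModuli E) K w) /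
                (localDegree (fieldOfModuli E) (Literature.IUT.LogVolume.finBelow (fieldOfModuli E) K w) : ℝ)) := by rw [key]
      _ = _ := by ring
  · have hv : Literature.IUT.LogVolume.finBelow (fieldOfModuli E) K w ∉ (ThetaData.pilotData D).S :=
      fun h => hw ((mem_S_pilotDataOfK_iff_finBelow_mem D w).mpr h)
    rw [(pilotDataOfK D K).qPilot_apply_of_not_mem hw, (ThetaData.pilotData D).qPilot_apply_of_not_mem hv]
    simp

omit hlog in
/-- **`‖t_{q,x}‖ = p^{−P_{q,K}(w)/e_w}` with `w = placeOfM x` the place of `K` of the member `x ∈ V̲_u`** — for EVERY member (bad or not) and ANY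
`F_mod`: abc-iut-w5-d166's `log_norm_tqM` (`log ‖t_{q,x}‖ = −P_{q,mod}(v)·log N(v)/n_v`, `v = placeModOfM x`), the place identity
`finBelow F_mod K (placeOfM x) = placeModOfM x` (`Ideal.under_under`), the field-independence above and `log N(w)/n_w = log p/e_w`.
[cite: DupuyHilado2025, §3.4, §3.9] [cite: NeukirchANT1999, Ch. I §8 Prop. (8.2)] -/
theorem WRowM.norm_tqM_eq_rpow_qPilot_placeOfM (u : FinitePlace ℚ) (x : (thetaIndexOfInitial D).Fibre (Val.non u)) :
    ‖tqM D (ratChar u) u (natCast_ratChar_mem u) r x‖ =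
      ((ratChar u : ℕ) : ℝ) ^ (-((pilotDataOfK D K).qPilot (placeOfM D u x) / (ramIdx K (placeOfM D u x) : ℝ))) := by
  have h := log_norm_tqM D (ratChar u) u (natCast_ratChar_mem u) r x
  have hv : Literature.IUT.LogVolume.finBelow (fieldOfModuli E) K (placeOfM D u x) = placeModOfM D u x := by
    show _ = ((placeOfM D u x).under (𝓞 F)).under (𝓞 (fieldOfModuli E))
    rw [← finBelow_eq_under (fieldOfModuli E) F, ← finBelow_eq_under F K, finBelow_finBelow (fieldOfModuli E) F K]
  have hb := WRowM.qPilot_pilotDataOfK_mul_logNorm_div_localDegree D (placeOfM D u x)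
  rw [hv] at hb
  have h2 : Real.log ‖tqM D (ratChar u) u (natCast_ratChar_mem u) r x‖ =
      -((pilotDataOfK D K).qPilot (placeOfM D u x) * logNorm K (placeOfM D u x) / (localDegree K (placeOfM D u x) : ℝ)) := by
    rw [hb, h]; ring
  rw [mul_div_assoc, logNorm_div_localDegree_eq_log_div_ramIdx,
    residueChar_placeOfM D (ratChar u) u (natCast_ratChar_mem u) x] at h2
  have hq0 : 0 < ‖tqM D (ratChar u) u (natCast_ratChar_mem u) r x‖ :=
    norm_pos_iff.mpr (tqM_ne_zero D (ratChar u) u (natCast_ratChar_mem u) r x)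
  have hp0 : (0 : ℝ) < ((ratChar u : ℕ) : ℝ) := by exact_mod_cast (Fact.out : (ratChar u).Prime).pos
  rw [← Real.exp_log hq0, h2, Real.rpow_def_of_pos hp0]
  congr 1
  ring

/-! ## §2. The K→M transfer mixed socket -/

/-- **THE (xi-f) LICENCE AT THE M-LEVEL SETTING OF THE OWN IDELES, AT FIBRES OF SEVERAL TYPES, FROM THE K-SIDE PACKAGES** (ANY `F_mod`,
no rationality of `j`). Hypotheses LETTER FOR LETTER abc-iut-w5-d180's `Thm311.Real.licence_settingPrVolSharp_of_mixedOrders_of_realises` at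
`X := pilotDataOfK D K`: a TYPE map `c` on the K-fibres; per type `(e, D, P, ρin, ρout)`; `hloc` (index, different, q-degree `P_q(x) = P`, inner
non-member, outer member at every BAD K-fibre point), `hiso` (same type ⇒ `ℚ_p`-isomorphic completions), `hcell` (per label and realised type
profile SOME slot with the composer's inequality). THEN `Thm311ToCor312.Licence` at `settingPrVolSharpM D hlog (tOfIdeleData D r) (tqM … r …) …`.
Proof: abc-iut-w5-d166's general decider at W-row-1's radii binders of every `K_{v̲}`; per summand the K-fibre points `x′_a` on the places
`placeOfM (v⃗ a)`; a GOOD slot forces `p^m ≤ ∏‖cin‖ ≤ ∏‖cout‖`; all slots bad: type profile `a ↦ c (x′_a)`, the K cell's slot, one-sided radii,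
`‖t_{q,v⃗ a}‖ = p^{−P/e}` (§1), the different gain with models the K completions at bad representatives of the occurring types, and abc-iut-w5-d180's
exponent bookkeeping VERBATIM. [cite: Mochizuki2012, IUTchI Def. 3.1 (b),(c),(e) pp. 61–62; IUTchIII Cor. 3.12 p. 173–175, Step (xi-d)(xi-f)
p. 183–184, Thm. 3.11 (i) p. 154; IUTchIV Prop. 1.1 p. 9, Prop. 1.2 (i)(ii) p. 10, Prop. 1.4 (i) p. 13] [cite: DupuyHilado2025, §3.3, §3.4, §3.9,
§4.9, §4.12] [cite: NeukirchANT1999, Ch. II (4.8), (5.5)] [claim: Mochizuki2012, status: disputed] -/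
theorem WRowM.licence_tOfIdeleData_of_mixedOrdersK (ty : Nat.Primes → ℕ)
    (c : ∀ pp : Nat.Primes, (thetaIndex (pilotDataOfK D K)).Fibre (.inr pp) → Fin (ty pp))
    (e Dd P : ∀ pp : Nat.Primes, Fin (ty pp) → ℕ) (ρin ρout : ∀ pp : Nat.Primes, Fin (ty pp) → ℤ)
    (hloc : ∀ (pp : Nat.Primes) (x : (thetaIndex (pilotDataOfK D K)).Fibre (.inr pp)),
      haveI : Fact (pp : ℕ).Prime := ⟨pp.2⟩
      placeOf (pilotDataOfK D K) pp.1 x ∈ (pilotDataOfK D K).S →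
        absRamificationIdx (pp : ℕ) (kOf (pilotDataOfK D K) pp.1 x) = e pp (c pp x) ∧
        (Dd pp (c pp x) : ℝ) / (e pp (c pp x) : ℝ) ≤ differentOrd (pp : ℕ) (kOf (pilotDataOfK D K) pp.1 x) ∧
        (pilotDataOfK D K).qPilot (placeOf (pilotDataOfK D K) pp.1 x) = P pp (c pp x) ∧
        (∃ z : kOf (pilotDataOfK D K) pp.1 x, z ∉ logUnits (kOf (pilotDataOfK D K) pp.1 x) ∧
          ‖z‖ ≤ ((pp : ℕ) : ℝ) ^ (-(((ρin pp (c pp x) : ℝ) - 1) / (e pp (c pp x) : ℝ)))) ∧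
        (∃ z ∈ logUnits (kOf (pilotDataOfK D K) pp.1 x), ((pp : ℕ) : ℝ) ^ (-((ρout pp (c pp x) : ℝ) / (e pp (c pp x) : ℝ))) ≤ ‖z‖))
    (hiso : ∀ (pp : Nat.Primes) (x y : (thetaIndex (pilotDataOfK D K)).Fibre (.inr pp)),
      haveI : Fact (pp : ℕ).Prime := ⟨pp.2⟩
      placeOf (pilotDataOfK D K) pp.1 x ∈ (pilotDataOfK D K).S → placeOf (pilotDataOfK D K) pp.1 y ∈ (pilotDataOfK D K).S →
        c pp x = c pp y → Nonempty (kOf (pilotDataOfK D K) pp.1 x ≃ₐ[ℚ_[pp]] kOf (pilotDataOfK D K) pp.1 y))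
    (hcell : ∀ (pp : Nat.Primes) (i : Fin (pilotDataOfK D K).lstar)
      (f : (thetaIndex (pilotDataOfK D K)).Caps (Setting.labelSucc i) → Fin (ty pp)),
      (haveI : Fact (pp : ℕ).Prime := ⟨pp.2⟩
        ∀ a, ∃ x : (thetaIndex (pilotDataOfK D K)).Fibre (.inr pp), placeOf (pilotDataOfK D K) pp.1 x ∈ (pilotDataOfK D K).S ∧ c pp x = f a) →
      ∃ s : (thetaIndex (pilotDataOfK D K)).Caps (Setting.labelSucc i), ∀ m : ℤ,
        ((m : ℝ) ≤ ((((i : ℕ) + 1 : ℕ) : ℝ) ^ 2 * (P pp (f s) : ℝ)) / (e pp (f s) : ℝ)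
            - ((∑ a, (Dd pp (f a) : ℝ) / (e pp (f a) : ℝ)) - ∑ u ∈ (Finset.univ.image f), (Dd pp u : ℝ) / (e pp u : ℝ))
            - ∑ a, (ρin pp (f a) : ℝ) / (e pp (f a) : ℝ)) →
        ((m : ℝ) ≤ (P pp (f (Fin.last _)) : ℝ) / (e pp (f (Fin.last _)) : ℝ) - ∑ a, (ρout pp (f a) : ℝ) / (e pp (f a) : ℝ))) :
    Thm311ToCor312.Licence
      (settingPrVolSharpM D hlog (tOfIdeleData D r) (fun u x => tqM D (ratChar u) u (natCast_ratChar_mem u) r x) M archPk archSub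
        Ψ act Mmod region n lat sig split qData htq0 Sq htq1) := by
  classical
  have hlstarK : (pilotDataOfK D K).lstar = (l - 1) / 2 := by
    show ((pilotDataOfK D K).l - 1) / 2 = (l - 1) / 2
    rw [pilotDataOfK_l]
  have hlstarM : (thetaIndexOfInitial D).lstar = (l - 1) / 2 := by
    show ((ThetaData.pilotData D).l - 1) / 2 = (l - 1) / 2
    rw [ThetaData.pilotData_l]
  -- W-row-1's radii binders at every `K_{v̲}`, then abc-iut-w5-d166's general decider
  have hB : ∀ (u : FinitePlace ℚ) (x : (thetaIndexOfInitial D).Fibre (Val.non u)),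
      ∃ cin cout : kOfM D (ratChar u) u (natCast_ratChar_mem u) x,
        cin ≠ 0 ∧ (∀ o : kOfM D (ratChar u) u (natCast_ratChar_mem u) x, ‖o‖ ≤ 1 →
          cin * o ∈ logUnits (kOfM D (ratChar u) u (natCast_ratChar_mem u) x)) ∧
        (∃ (ϖ : (kOfM D (ratChar u) u (natCast_ratChar_mem u) x)ˣ) (w : kOfM D (ratChar u) u (natCast_ratChar_mem u) x),
          IsUniformizer ϖ ∧ w ∉ logUnits (kOfM D (ratChar u) u (natCast_ratChar_mem u) x) ∧
            ‖w‖ * ‖(ϖ : kOfM D (ratChar u) u (natCast_ratChar_mem u) x)‖ ≤ ‖cin‖) ∧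
        cout ≠ 0 ∧ cout ∈ logUnits (kOfM D (ratChar u) u (natCast_ratChar_mem u) x) ∧
          ∀ z ∈ logUnits (kOfM D (ratChar u) u (natCast_ratChar_mem u) x), ‖z‖ ≤ ‖cout‖ :=
    fun u x => exists_shellRadii_binders (ratChar u) (kOfM D (ratChar u) u (natCast_ratChar_mem u) x)
  choose cin cout hin0 hin hmax hout0 houtΛ hdom using hB
  refine (licence_settingPrVolSharpM_tOfIdeleData_iff_radii D hlog r M archPk archSub Ψ act Mmod region n lat sig split qData htq0 Sq
    htq1 cin cout hin0 hin hmax houtΛ hdom).2 fun u i ev m hm => ?_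
  set pp : Nat.Primes := ⟨ratChar u, Fact.out⟩ with hpp
  -- the K-fibre point on the place of a member (a function of the member), badness transported to `(pilotDataOfK D K)`
  let kpt : ∀ (x : (thetaIndexOfInitial D).Fibre (Val.non u)), (thetaIndex (pilotDataOfK D K)).Fibre (.inr pp) := fun x =>
    (fibreEquivPlacesOver (pilotDataOfK D K) pp).symm
      ⟨placeOfM D u x, placeOfM_mem_placesOver D (ratChar u) u (natCast_ratChar_mem u) x⟩
  have hkpt : ∀ x, placeOf (pilotDataOfK D K) pp.1 (kpt x) = placeOfM D u x := by
    intro x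
    show (fibreEquivPlacesOver (pilotDataOfK D K) pp ((fibreEquivPlacesOver (pilotDataOfK D K) pp).symm _)).1 = _
    rw [Equiv.apply_symm_apply]
  have hbadK : ∀ x, placeModOfM D u x ∈ (ThetaData.pilotData D).S → placeOf (pilotDataOfK D K) pp.1 (kpt x) ∈ (pilotDataOfK D K).S := by
    intro x hx
    rw [hkpt, mem_pilotDataOfK_S_iff, ThetaData.mk_mem_VFbad_iff]
    rw [ThetaData.pilotData_S] at hx
    exact hx
  have hp1 : (1 : ℝ) < ((ratChar u : ℕ) : ℝ) := by exact_mod_cast (Fact.out : (ratChar u).Prime).one_lt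
  have hp0 : (0 : ℝ) < ((ratChar u : ℕ) : ℝ) := by linarith
  -- `‖cin‖ ≤ ‖cout‖` at every member, products nonnegative
  have hinout : ∀ x : (thetaIndexOfInitial D).Fibre (Val.non u), ‖cin u x‖ ≤ ‖cout u x‖ := fun x =>
    hdom u x _ (by simpa using hin u x 1 (by simp))
  have hprod_le : ∏ a, ‖cin u (ev a)‖ ≤ ∏ a, ‖cout u (ev a)‖ :=
    Finset.prod_le_prod (fun a _ => norm_nonneg _) fun a _ => hinout (ev a)
  have hprod_nn : 0 ≤ ∏ a, ‖cin u (ev a)‖ := Finset.prod_nonneg fun a _ => norm_nonneg _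
  by_cases hall : ∀ a, placeModOfM D u (ev a) ∈ (ThetaData.pilotData D).S
  swap
  · -- a GOOD slot `a₀` (abc-iut-W-row-1's argument): `‖t_{q,v̲_{a₀}}‖ = 1`, so `p^m ≤ ∏‖cin‖ ≤ ∏‖cout‖`, and `‖t_{q,last}‖ ≤ 1`
    push Not at hall
    obtain ⟨a₀, ha₀⟩ := hall
    obtain ⟨J₀⟩ := (inferInstance : Nonempty (DIdx (ratChar u) ((presAtM D hlog u).kk ev)))
    have hJ := hm a₀ J₀
    rw [norm_tqM_eq_one_of_not_mem D (ratChar u) u (natCast_ratChar_mem u) r (ev a₀) ha₀, one_pow, mul_one] at hJ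
    have hexp : ((ratChar u : ℕ) : ℝ) ^ (-(dSum (ratChar u) ((presAtM D hlog u).kk ev) -
        differentOrd (ratChar u) (DFac (ratChar u) ((presAtM D hlog u).kk ev) J₀))) ≤ 1 :=
      Real.rpow_le_one_of_one_le_of_nonpos hp1.le (by
        have := differentOrd_dFac_le_dSum (ratChar u) ((presAtM D hlog u).kk ev) J₀
        linarith)
    have hm' : ((ratChar u : ℕ) : ℝ) ^ m ≤ ∏ a, ‖cout u (ev a)‖ :=
      hJ.trans ((mul_le_of_le_one_left hprod_nn hexp).trans hprod_le)
    exact (mul_le_of_le_one_right (zpow_nonneg hp0.le _) (norm_tqM_le_one D r u (ev (Fin.last _)))).trans hm'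
  · -- ALL slots bad: the K-fibre points `x′_a`, their type profile and abc-iut-w5-d180's K cell at the composer's slot
    have hallK : ∀ a, placeOf (pilotDataOfK D K) pp.1 (kpt (ev a)) ∈ (pilotDataOfK D K).S := fun a => hbadK (ev a) (hall a)
    have hi : (i : ℕ) < (pilotDataOfK D K).lstar := by rw [hlstarK, ← hlstarM]; exact i.isLt
    obtain ⟨s, hs⟩ := hcell pp ⟨i, hi⟩ (fun a => c pp (kpt (ev a))) (fun a => ⟨kpt (ev a), hallK a, rfl⟩)
    -- the index of the member IS that of its K-fibre point (same rescaled completion on the same place)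
    have heK : ∀ a, absRamificationIdx (pp : ℕ) (kOf (pilotDataOfK D K) pp.1 (kpt (ev a))) =
        absRamificationIdx (ratChar u) (kOfM D (ratChar u) u (natCast_ratChar_mem u) (ev a)) := by
      intro a
      show absRamificationIdx (ratChar u) (kOf (pilotDataOfK D K) (ratChar u) (kpt (ev a))) = _
      rw [absRamificationIdx_rescaledCompletion, absRamificationIdx_rescaledCompletion, hkpt]
    have he : ∀ a, absRamificationIdx (ratChar u) (kOfM D (ratChar u) u (natCast_ratChar_mem u) (ev a)) = e pp (c pp (kpt (ev a))) :=
      fun a => (heK a).symm.trans (hloc pp (kpt (ev a)) (hallK a)).1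
    have hepos : ∀ a, 0 < e pp (c pp (kpt (ev a))) := fun a => by
      rw [← he a]; exact absRamificationIdx_pos (ratChar u) (kOfM D (ratChar u) u (natCast_ratChar_mem u) (ev a))
    -- `‖t_{q,v̲_a}‖ = p^{−P/e}` (§1: the K q-pilot degree at `placeOfM = placeOf x′`, `e_w = e`)
    have hram : ∀ a, (ramIdx K (placeOfM D u (ev a)) : ℝ) = e pp (c pp (kpt (ev a))) := fun a => by
      rw [← hkpt (ev a), ramIdx_eq K (placeOf (pilotDataOfK D K) pp.1 (kpt (ev a))),
        ← absRamificationIdx_rescaledCompletion K (pp : ℕ) (placeOf (pilotDataOfK D K) pp.1 (kpt (ev a))) (natCast_mem_placeOf (pilotDataOfK D K) pp.1 (kpt (ev a)))]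
      exact_mod_cast (hloc pp (kpt (ev a)) (hallK a)).1
    have hq : ∀ a, ‖tqM D (ratChar u) u (natCast_ratChar_mem u) r (ev a)‖ =
        ((ratChar u : ℕ) : ℝ) ^ (-((P pp (c pp (kpt (ev a))) : ℝ) / (e pp (c pp (kpt (ev a))) : ℝ))) := by
      intro a
      rw [WRowM.norm_tqM_eq_rpow_qPilot_placeOfM D r u (ev a), hram a, ← hkpt (ev a), (hloc pp (kpt (ev a)) (hallK a)).2.2.1]
    have hΘ : ∀ a, ‖tqM D (ratChar u) u (natCast_ratChar_mem u) r (ev a)‖ ^ (((i : ℕ) + 1) ^ 2) =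
        ((ratChar u : ℕ) : ℝ) ^ (-((((i : ℕ) + 1 : ℕ) : ℝ) ^ 2 * (P pp (c pp (kpt (ev a))) : ℝ)) /
          (e pp (c pp (kpt (ev a))) : ℝ)) := by
      intro a
      rw [hq a, ← Real.rpow_natCast, ← Real.rpow_mul hp0.le]
      congr 1
      push_cast
      ring
    -- one-sided radii at every slot, read off the K packages at the K-fibre points
    -- transport of the shell witnesses along `placeOf x′ = placeOfM x` (same rescaled completion)
    have hin_tr : ∀ {v w : HeightOneSpectrum (𝓞 K)} (_ : v = w) (hv : ((ratChar u : ℕ) : 𝓞 K) ∈ v.asIdeal)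
        (hw : ((ratChar u : ℕ) : 𝓞 K) ∈ w.asIdeal) (Q : ∀ L : Type, [NontriviallyNormedField L] → [NormedAlgebra ℚ_[ratChar u] L] → Prop),
        Q (RescaledCompletion K (ratChar u) v hv) → Q (RescaledCompletion K (ratChar u) w hw) := by
      intro v w hvw; subst hvw; intro hv hw Q hQ; exact hQ
    have hin_le : ∀ a, ‖cin u (ev a)‖ ≤
        ((ratChar u : ℕ) : ℝ) ^ (-((ρin pp (c pp (kpt (ev a))) : ℝ) / (e pp (c pp (kpt (ev a))) : ℝ))) := by
      intro a
      obtain ⟨-, -, -, hz0, -⟩ := hloc pp (kpt (ev a)) (hallK a)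
      obtain ⟨z, hz, hzle⟩ := hin_tr (hkpt (ev a)) (natCast_mem_placeOf (pilotDataOfK D K) (ratChar u) (kpt (ev a)))
        (natCast_mem_placeOfM D (ratChar u) u (natCast_ratChar_mem u) (ev a))
        (fun L _ _ => ∃ z : L, z ∉ logUnits L ∧ ‖z‖ ≤ ((ratChar u : ℕ) : ℝ) ^
          (-(((ρin pp (c pp (kpt (ev a))) : ℝ) - 1) / (e pp (c pp (kpt (ev a))) : ℝ)))) hz0
      have h := norm_inner_le_of_not_mem (ratChar u) (kOfM D (ratChar u) u (natCast_ratChar_mem u) (ev a)) (hin u (ev a)) hz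
        (ρ := ρin pp (c pp (kpt (ev a)))) (by rw [he a]; exact hzle)
      rw [he a] at h
      exact h
    have hout_ge : ∀ a, ((ratChar u : ℕ) : ℝ) ^ (-((ρout pp (c pp (kpt (ev a))) : ℝ) / (e pp (c pp (kpt (ev a))) : ℝ))) ≤
        ‖cout u (ev a)‖ := by
      intro a
      obtain ⟨-, -, -, -, hz0⟩ := hloc pp (kpt (ev a)) (hallK a)
      obtain ⟨z, hz, hzge⟩ := hin_tr (hkpt (ev a)) (natCast_mem_placeOf (pilotDataOfK D K) (ratChar u) (kpt (ev a)))
        (natCast_mem_placeOfM D (ratChar u) u (natCast_ratChar_mem u) (ev a))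
        (fun L _ _ => ∃ z ∈ logUnits L, ((ratChar u : ℕ) : ℝ) ^
          (-((ρout pp (c pp (kpt (ev a))) : ℝ) / (e pp (c pp (kpt (ev a))) : ℝ))) ≤ ‖z‖) hz0
      exact hzge.trans (hdom u (ev a) z hz)
    have hprod_in : ∏ a, ‖cin u (ev a)‖ ≤
        ((ratChar u : ℕ) : ℝ) ^ (∑ a, -((ρin pp (c pp (kpt (ev a))) : ℝ) / (e pp (c pp (kpt (ev a))) : ℝ))) := by
      rw [Real.rpow_sum_of_pos hp0]
      exact Finset.prod_le_prod (fun a _ => norm_nonneg _) fun a _ => hin_le a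
    have hprod_out : ((ratChar u : ℕ) : ℝ) ^ (∑ a, -((ρout pp (c pp (kpt (ev a))) : ℝ) / (e pp (c pp (kpt (ev a))) : ℝ))) ≤
        ∏ a, ‖cout u (ev a)‖ := by
      rw [Real.rpow_sum_of_pos hp0]
      exact Finset.prod_le_prod (fun a _ => by positivity) fun a _ => hout_ge a
    -- the different gain from below (abc-iut-w5-d180 §1), models = the K completions at bad representatives of the occurring types
    have hrep : ∀ t : Fin (ty pp), ∃ y : (thetaIndex (pilotDataOfK D K)).Fibre (.inr pp),
        (∃ x : (thetaIndex (pilotDataOfK D K)).Fibre (.inr pp), placeOf (pilotDataOfK D K) pp.1 x ∈ (pilotDataOfK D K).S ∧ c pp x = t) → placeOf (pilotDataOfK D K) pp.1 y ∈ (pilotDataOfK D K).S ∧ c pp y = t := by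
      intro t
      by_cases h : ∃ x : (thetaIndex (pilotDataOfK D K)).Fibre (.inr pp), placeOf (pilotDataOfK D K) pp.1 x ∈ (pilotDataOfK D K).S ∧ c pp x = t
      · obtain ⟨x, hx⟩ := h; exact ⟨x, fun _ => hx⟩
      · exact ⟨kpt (ev (Fin.last _)), fun h' => absurd h' h⟩
    choose rep hrep using hrep
    have hrep' : ∀ a, placeOf (pilotDataOfK D K) pp.1 (rep (c pp (kpt (ev a)))) ∈ (pilotDataOfK D K).S ∧ c pp (rep (c pp (kpt (ev a)))) = c pp (kpt (ev a)) := fun a =>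
      hrep _ ⟨kpt (ev a), hallK a, rfl⟩
    have castAlg : ∀ {v w : HeightOneSpectrum (𝓞 K)} (_ : v = w)
        (hv : ((ratChar u : ℕ) : 𝓞 K) ∈ v.asIdeal) (hw : ((ratChar u : ℕ) : 𝓞 K) ∈ w.asIdeal),
        Nonempty (RescaledCompletion K (ratChar u) v hv ≃ₐ[ℚ_[ratChar u]] RescaledCompletion K (ratChar u) w hw) := by
      intro v w hvw; subst hvw; intro hv hw; exact ⟨AlgEquiv.refl⟩
    have τ : ∀ a, kOf (pilotDataOfK D K) pp.1 (rep (c pp (kpt (ev a)))) ≃ₐ[ℚ_[pp]] (presAtM D hlog u).kk ev a := fun a =>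
      (Classical.choice (hiso pp (rep (c pp (kpt (ev a)))) (kpt (ev a)) (hrep' a).1 (hallK a) (hrep' a).2)).trans
        (Classical.choice (castAlg (hkpt (ev a)) (natCast_mem_placeOf (pilotDataOfK D K) (ratChar u) (kpt (ev a)))
          (natCast_mem_placeOfM D (ratChar u) u (natCast_ratChar_mem u) (ev a))))
    have hgain := sub_le_dSum_sub_inf_differentOrd_dFac_of_types (ratChar u) ((presAtM D hlog u).kk ev)
      (fun t : Fin (ty pp) => kOf (pilotDataOfK D K) pp.1 (rep t)) (fun a => c pp (kpt (ev a))) τ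
      (fun t => (Dd pp t : ℝ) / (e pp t : ℝ)) (by
        intro t ht
        obtain ⟨a, -, rfl⟩ := Finset.mem_image.mp ht
        obtain ⟨-, hD, -, -, -⟩ := hloc pp (rep (c pp (kpt (ev a)))) (hrep' a).1
        rw [(hrep' a).2] at hD
        exact hD)
    -- collapse the `∀ J` premiss at the composer's slot `s` to the least factor different, then to one power of `p`
    have hms : ∀ J : DIdx (ratChar u) ((presAtM D hlog u).kk ev),
        ((ratChar u : ℕ) : ℝ) ^ m * ((ratChar u : ℕ) : ℝ) ^ (-((((i : ℕ) + 1 : ℕ) : ℝ) ^ 2 * (P pp (c pp (kpt (ev s))) : ℝ)) /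
            (e pp (c pp (kpt (ev s))) : ℝ)) ≤
          ((ratChar u : ℕ) : ℝ) ^ (-(dSum (ratChar u) ((presAtM D hlog u).kk ev) -
            differentOrd (ratChar u) (DFac (ratChar u) ((presAtM D hlog u).kk ev) J))) * ∏ b, ‖cin u (ev b)‖ := by
      intro J
      have h := hm s J
      rw [hΘ s] at h
      exact h
    have hm1 := (forall_dFac_le_rpow_mul_iff_inf (ratChar u) ((presAtM D hlog u).kk ev) hprod_nn).1 hms
    set G : ℝ := (∑ a, (Dd pp (c pp (kpt (ev a))) : ℝ) / (e pp (c pp (kpt (ev a))) : ℝ)) -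
      ∑ t ∈ (Finset.univ.image fun a => c pp (kpt (ev a))), (Dd pp t : ℝ) / (e pp t : ℝ) with hG
    have hΔle : ((ratChar u : ℕ) : ℝ) ^ (-(dSum (ratChar u) ((presAtM D hlog u).kk ev) -
        (Finset.univ : Finset (DIdx (ratChar u) ((presAtM D hlog u).kk ev))).inf' Finset.univ_nonempty
          (fun J => differentOrd (ratChar u) (DFac (ratChar u) ((presAtM D hlog u).kk ev) J)))) ≤ ((ratChar u : ℕ) : ℝ) ^ (-G) :=
      Real.rpow_le_rpow_of_exponent_le hp1.le (by linarith [hgain])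
    have hm2 : ((ratChar u : ℕ) : ℝ) ^ m * ((ratChar u : ℕ) : ℝ) ^ (-((((i : ℕ) + 1 : ℕ) : ℝ) ^ 2 * (P pp (c pp (kpt (ev s))) : ℝ)) /
          (e pp (c pp (kpt (ev s))) : ℝ)) ≤
        ((ratChar u : ℕ) : ℝ) ^ (-G) *
          ((ratChar u : ℕ) : ℝ) ^ (∑ a, -((ρin pp (c pp (kpt (ev a))) : ℝ) / (e pp (c pp (kpt (ev a))) : ℝ))) :=
      hm1.trans (mul_le_mul hΔle hprod_in hprod_nn (by positivity))
    rw [← Real.rpow_intCast, ← Real.rpow_add hp0, ← Real.rpow_add hp0, Real.rpow_le_rpow_left_iff hp1] at hm2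
    have hant : (m : ℝ) ≤ ((((i : ℕ) + 1 : ℕ) : ℝ) ^ 2 * (P pp (c pp (kpt (ev s))) : ℝ)) / (e pp (c pp (kpt (ev s))) : ℝ) - G -
        ∑ a, (ρin pp (c pp (kpt (ev a))) : ℝ) / (e pp (c pp (kpt (ev a))) : ℝ) := by
      have hsum : ∑ a, -((ρin pp (c pp (kpt (ev a))) : ℝ) / (e pp (c pp (kpt (ev a))) : ℝ)) =
          -∑ a, (ρin pp (c pp (kpt (ev a))) : ℝ) / (e pp (c pp (kpt (ev a))) : ℝ) := by
        rw [Finset.sum_neg_distrib]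
      rw [hsum] at hm2
      linarith [hm2, neg_div (e pp (c pp (kpt (ev s))) : ℝ) ((((i : ℕ) + 1 : ℕ) : ℝ) ^ 2 * (P pp (c pp (kpt (ev s))) : ℝ))]
    -- the composer's cell (read back on the M caps: the two `Fin` index types agree definitionally)
    have hcons : (m : ℝ) ≤ (P pp (c pp (kpt (ev (Fin.last _)))) : ℝ) / (e pp (c pp (kpt (ev (Fin.last _)))) : ℝ) -
        ∑ a, (ρout pp (c pp (kpt (ev a))) : ℝ) / (e pp (c pp (kpt (ev a))) : ℝ) := hs m (by rw [hG] at hant; exact hant)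
    -- back to norms: `p^m·‖t_q(last)‖ = p^m·p^{−P/e} ≤ p^{−Σ ρout/e} ≤ ∏‖cout‖`
    rw [hq (Fin.last _)]
    refine le_trans ?_ hprod_out
    rw [← Real.rpow_intCast, ← Real.rpow_add hp0, Real.rpow_le_rpow_left_iff hp1]
    have hsum : ∑ a, -((ρout pp (c pp (kpt (ev a))) : ℝ) / (e pp (c pp (kpt (ev a))) : ℝ)) =
        -∑ a, (ρout pp (c pp (kpt (ev a))) : ℝ) / (e pp (c pp (kpt (ev a))) : ℝ) := by
      rw [Finset.sum_neg_distrib]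
    rw [hsum]
    linarith [hcons, neg_div (e pp (c pp (kpt (ev (Fin.last _)))) : ℝ) (P pp (c pp (kpt (ev (Fin.last _)))) : ℝ)]

end Own

end Summit.ABC.IUTFork.Conditional

end
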